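import Mathlib
import Literature.AlgebraicGeometry.Resolution.Blowups
import Literature.AlgebraicGeometry.Resolution.BlowupsExistence
import Literature.AlgebraicGeometry.Resolution.BlowupsProperProofs
import Literature.AlgebraicGeometry.Resolution.BlowupsIntegral
import Literature.AlgebraicGeometry.Resolution.ResolutionGlue

/-!
# The «one more blow-up» exit: resolving by blowing up a locus whose local blow-ups are regular

Crux stmt-ResolutionOfSingularities-15640 (`WildQuotients.WildQuotientResolution`), line `Sketch`,
sector `|G| = p`; programme V3U of CHAIN w45c (plan-1 RULING pre-v5, 2026-08-27T01:38Z), row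
**V3U-E** (res-L1-w45c-stub-3). [OURS · L1 W4.5c] — generic scheme-level glue, NOT a statement of
the manuscript.

`hasResolution_of_isBlowup_local`: let `Y` be an integral locally Noetherian scheme, `𝓘` a
non-zero ideal sheaf on `Y`, and `U`, `W` opens covering `Y` such that `W` is regular and misses
the centre (`𝓘|_W = ⊤`), while SOME blow-up of `U` along `𝓘|_U` is regular. Then `Y` has a
resolution of singularities: the blow-up `π : Ỹ → Y` of `Y` along `𝓘` (it exists for every ideal
sheaf, `exists_isBlowup`) is proper (`IsBlowup.isProper`) and birational
(`IsBlowup.isBirational'`), and `Ỹ` is regular because `π` restricts over `U` to a blow-up of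
`U` along `𝓘|_U` (`IsBlowup.restrict`), isomorphic to the given regular one (`IsBlowup.unique`),
and over `W` to an isomorphism (`IsBlowup.isIso`). Intended use (V3U-F): `Y = V/σ` the quotient of
the weighted-blow-up model of `𝔸ⁿ/J₃`, `W` = the regular chart, `U` = the `A₁`-cone chart,
`𝓘 = 𝓘_Z` the ideal of the cone-vertex locus.
-/

-- single-problem summit: the doubled namespace component `ResolutionOfSingularities` is forced
set_option linter.dupNamespace false

noncomputable section

universe u

open CategoryTheory AlgebraicGeometry TopologicalSpace
open Literature.AlgebraicGeometry.Resolution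

namespace Summit.ResolutionOfSingularities.ResolutionOfSingularities.Theorems.WildQuotientResolution.BlowupExit

/-- **Regularity of an open subscheme transfers to the points of the ambient scheme it contains**
(stalks along an open immersion are isomorphic). [folklore] -/
theorem isRegularLocalRing_stalk_of_mem {X : Scheme.{u}} (V : X.Opens)
    (hV : Scheme.IsRegular (V : Scheme.{u})) (x : X) (hx : x ∈ V) :
    IsRegularLocalRing (X.presheaf.stalk x) := by
  let x' : (V : Scheme.{u}) := ⟨x, hx⟩
  haveI := hV x'
  exact IsRegularLocalRing.of_ringEquiv (asIso (V.ι.stalkMap x')).commRingCatIsoToRingEquiv.symm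

/-- **A scheme covered by two regular opens is regular.** [folklore] -/
theorem isRegular_of_isRegular_opens {X : Scheme.{u}} (V₁ V₂ : X.Opens) (h : V₁ ⊔ V₂ = ⊤)
    (h₁ : Scheme.IsRegular (V₁ : Scheme.{u})) (h₂ : Scheme.IsRegular (V₂ : Scheme.{u})) :
    Scheme.IsRegular X := by
  intro x
  have hx : x ∈ V₁ ⊔ V₂ := by
    rw [h]
    exact Opens.mem_top x
  rcases Opens.mem_sup.mp hx with hx | hx
  · exact isRegularLocalRing_stalk_of_mem V₁ h₁ x hx
  · exact isRegularLocalRing_stalk_of_mem V₂ h₂ x hx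

/-- **The preimage of the regular part off the centre is regular**: if `π` is a blow-up of `Y`
along `𝓘` and the open `W ⊆ Y` is regular with `𝓘|_W = ⊤`, then `π⁻¹ W` is regular (`π` is an
isomorphism over `W`: `IsBlowup.restrict` + `IsBlowup.isIso`). [cite: GortzWedhorn2020, Prop. 13.91] -/
theorem isRegular_preimage_of_comap_eq_top {Y' Y : Scheme.{u}} {π : Y' ⟶ Y} {𝓘 : Y.IdealSheafData}
    (hπ : IsBlowup π 𝓘) (W : Y.Opens) (hW : Scheme.IsRegular (W : Scheme.{u}))
    (h𝓘W : 𝓘.comap W.ι = ⊤) : Scheme.IsRegular (π ⁻¹ᵁ W : Scheme.{u}) := by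
  have hcart : IsEffectiveCartier (𝓘.comap W.ι) := by
    rw [h𝓘W]
    exact isEffectiveCartier_top
  haveI : IsIso (π ∣_ W) := (hπ.restrict W).isIso hcart
  exact Scheme.IsRegular.of_iso (inv (π ∣_ W)) hW

/-- **The preimage of `U` is regular as soon as one blow-up of `U` along `𝓘|_U` is**: `π`
restricts over `U` to a blow-up of `U` along `𝓘|_U` (`IsBlowup.restrict`), and blow-ups are
unique up to isomorphism (`IsBlowup.unique`). [cite: GortzWedhorn2020, (13.19) p. 413] -/
theorem isRegular_preimage_of_isBlowup_regular {Y' Y : Scheme.{u}} {π : Y' ⟶ Y}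
    {𝓘 : Y.IdealSheafData} (hπ : IsBlowup π 𝓘) (U : Y.Opens)
    (hU : ∃ (B : Scheme.{u}) (p : B ⟶ (U : Scheme.{u})), IsBlowup p (𝓘.comap U.ι) ∧
      Scheme.IsRegular B) :
    Scheme.IsRegular (π ⁻¹ᵁ U : Scheme.{u}) := by
  obtain ⟨B, p, hp, hB⟩ := hU
  obtain ⟨e, -, -⟩ := hp.unique (hπ.restrict U)
  exact Scheme.IsRegular.of_iso e.hom hB

/-- **V3U-E: the «one more blow-up» exit.** `Y` integral and locally Noetherian, `𝓘 ≠ ⊥` an ideal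
sheaf, `U ⊔ W = ⊤` opens with `W` regular and off the centre (`𝓘|_W = ⊤`), and some blow-up of
`U` along `𝓘|_U` regular ⟹ `Y` has a resolution of singularities, namely the blow-up of `Y`
along `𝓘` (`exists_isBlowup`; proper `IsBlowup.isProper`, birational `IsBlowup.isBirational'`,
regular by the two previous lemmas). [cite: GortzWedhorn2020, Prop. 13.91–13.92]
[cite: StacksProject, Tag 02ND] -/
theorem hasResolution_of_isBlowup_local {Y : Scheme.{u}} [IsIntegral Y] [IsLocallyNoetherian Y]
    (𝓘 : Y.IdealSheafData) (h𝓘 : 𝓘 ≠ ⊥) (U W : Y.Opens) (hUW : U ⊔ W = ⊤)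
    (hW : Scheme.IsRegular (W : Scheme.{u})) (h𝓘W : 𝓘.comap W.ι = ⊤)
    (hU : ∃ (B : Scheme.{u}) (p : B ⟶ (U : Scheme.{u})), IsBlowup p (𝓘.comap U.ι) ∧
      Scheme.IsRegular B) :
    Scheme.HasResolution Y := by
  obtain ⟨Y', π, hπ⟩ := exists_isBlowup Y 𝓘
  have hreg : Scheme.IsRegular Y' := by
    refine isRegular_of_isRegular_opens (π ⁻¹ᵁ U) (π ⁻¹ᵁ W) ?_
      (isRegular_preimage_of_isBlowup_regular hπ U hU)
      (isRegular_preimage_of_comap_eq_top hπ W hW h𝓘W)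
    rw [← Scheme.Hom.preimage_sup, hUW, Scheme.Hom.preimage_top]
  exact ⟨Y', π, ⟨hπ.isProper, hπ.isBirational' h𝓘, hreg⟩⟩

/-- **The same exit, recording the resolution as the blow-up itself** (useful when the caller
wants `IsResolution` of a specific `π`): any blow-up `π` of `Y` along `𝓘` is a resolution under
the hypotheses of `hasResolution_of_isBlowup_local`. [cite: GortzWedhorn2020, Prop. 13.91–13.92] -/
theorem isResolution_of_isBlowup_local {Y' Y : Scheme.{u}} [IsIntegral Y] [IsLocallyNoetherian Y]
    {π : Y' ⟶ Y} (𝓘 : Y.IdealSheafData) (hπ : IsBlowup π 𝓘) (h𝓘 : 𝓘 ≠ ⊥) (U W : Y.Opens)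
    (hUW : U ⊔ W = ⊤) (hW : Scheme.IsRegular (W : Scheme.{u})) (h𝓘W : 𝓘.comap W.ι = ⊤)
    (hU : ∃ (B : Scheme.{u}) (p : B ⟶ (U : Scheme.{u})), IsBlowup p (𝓘.comap U.ι) ∧
      Scheme.IsRegular B) :
    IsResolution π := by
  have hreg : Scheme.IsRegular Y' := by
    refine isRegular_of_isRegular_opens (π ⁻¹ᵁ U) (π ⁻¹ᵁ W) ?_
      (isRegular_preimage_of_isBlowup_regular hπ U hU)
      (isRegular_preimage_of_comap_eq_top hπ W hW h𝓘W)
    rw [← Scheme.Hom.preimage_sup, hUW, Scheme.Hom.preimage_top]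
  exact ⟨hπ.isProper, hπ.isBirational' h𝓘, hreg⟩

/-! ## Any finite (or arbitrary) number of pieces (V4U: several singular charts)

Appended 2026-08-27 (res-L1-w45c-stub-3): the same exit when the regular local blow-ups are
given on an arbitrary open cover `⨆ U i = ⊤`; a regular piece `W` off the centre (`𝓘|_W = ⊤`)
contributes the identity blow-up (`exists_isBlowup_regular_of_comap_eq_top`). -/

/-- **A scheme covered by regular opens is regular.** [folklore] -/
theorem isRegular_of_isRegular_iSup {X : Scheme.{u}} {ι : Type*} (V : ι → X.Opens)
    (h : ⨆ i, V i = ⊤) (hV : ∀ i, Scheme.IsRegular (V i : Scheme.{u})) :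
    Scheme.IsRegular X := by
  intro x
  have hx : x ∈ ⨆ i, V i := by
    rw [h]
    exact Opens.mem_top x
  obtain ⟨i, hi⟩ := Opens.mem_iSup.mp hx
  exact isRegularLocalRing_stalk_of_mem (V i) (hV i) x hi

/-- **A regular open off the centre has a regular blow-up along the (trivial) restricted
centre** — the identity (`isBlowup_id_top`). [folklore] -/
theorem exists_isBlowup_regular_of_comap_eq_top {Y : Scheme.{u}} (𝓘 : Y.IdealSheafData)
    (W : Y.Opens) (hW : Scheme.IsRegular (W : Scheme.{u})) (h𝓘W : 𝓘.comap W.ι = ⊤) :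
    ∃ (B : Scheme.{u}) (p : B ⟶ (W : Scheme.{u})), IsBlowup p (𝓘.comap W.ι) ∧
      Scheme.IsRegular B := by
  refine ⟨(W : Scheme.{u}), 𝟙 _, ?_, hW⟩
  rw [h𝓘W]
  exact isBlowup_id_top _

/-- **The exit on an open cover**: `Y` integral locally Noetherian, `𝓘 ≠ ⊥`, an open cover
`⨆ U i = ⊤` such that for every `i` SOME blow-up of `U i` along `𝓘|_{U i}` is regular ⟹ any
blow-up `π` of `Y` along `𝓘` is a resolution of singularities (`IsBlowup.restrict` +
`IsBlowup.unique` piece by piece). [cite: GortzWedhorn2020, Prop. 13.91–13.92] -/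
theorem isResolution_of_isBlowup_locally_regular {Y' Y : Scheme.{u}} [IsIntegral Y]
    [IsLocallyNoetherian Y] {π : Y' ⟶ Y} (𝓘 : Y.IdealSheafData) (hπ : IsBlowup π 𝓘) (h𝓘 : 𝓘 ≠ ⊥)
    {ι : Type*} (U : ι → Y.Opens) (hU : ⨆ i, U i = ⊤)
    (h : ∀ i, ∃ (B : Scheme.{u}) (p : B ⟶ (U i : Scheme.{u})), IsBlowup p (𝓘.comap (U i).ι) ∧
      Scheme.IsRegular B) :
    IsResolution π := by
  have hreg : Scheme.IsRegular Y' := by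
    refine isRegular_of_isRegular_iSup (fun i => π ⁻¹ᵁ U i) ?_
      (fun i => isRegular_preimage_of_isBlowup_regular hπ (U i) (h i))
    rw [← Scheme.Hom.preimage_iSup, hU, Scheme.Hom.preimage_top]
  exact ⟨hπ.isProper, hπ.isBirational' h𝓘, hreg⟩

/-- **The exit on an open cover, existence form**: under the hypotheses of
`isResolution_of_isBlowup_locally_regular`, `Y` has a resolution of singularities (the blow-up
of `Y` along `𝓘`, `exists_isBlowup`). Intended for V4U (`J₄`: a `μ₃`-chart, a `μ₂`-chart and
a regular chart). [cite: GortzWedhorn2020, Prop. 13.91–13.92] -/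
theorem hasResolution_of_isBlowup_locally_regular {Y : Scheme.{u}} [IsIntegral Y]
    [IsLocallyNoetherian Y] (𝓘 : Y.IdealSheafData) (h𝓘 : 𝓘 ≠ ⊥) {ι : Type*} (U : ι → Y.Opens)
    (hU : ⨆ i, U i = ⊤)
    (h : ∀ i, ∃ (B : Scheme.{u}) (p : B ⟶ (U i : Scheme.{u})), IsBlowup p (𝓘.comap (U i).ι) ∧
      Scheme.IsRegular B) :
    Scheme.HasResolution Y := by
  obtain ⟨Y', π, hπ⟩ := exists_isBlowup Y 𝓘
  exact ⟨Y', π, isResolution_of_isBlowup_locally_regular 𝓘 hπ h𝓘 U hU h⟩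

end Summit.ResolutionOfSingularities.ResolutionOfSingularities.Theorems.WildQuotientResolution.BlowupExit

end
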